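import Literature.NumberTheory.EllipticCurves.FineSelmerCongruentCurves
import Literature.NumberTheory.EllipticCurves.FineSelmerClassGroupCriterionThm34Proofs
import HarnessLib

/-!
# Stub S3 for birth.lean skeleton — crux WildCoatesSujathaResidue (item stmt-BirchSwinnertonDyer-19942)

This file proves `stub_publishedInputs_LS18_CS05`: the conjunction of the two named Literature facts
- Lim–Sujatha 2018 Prop. 3.2: (A) is an invariant of the mod-p Galois module
- Coates–Sujatha 2005 Thm. 3.4: classical μ = 0 for ℚ(E[p])_cyc ⇒ (A) at (E,p)

Both have `_holds` theorems in Literature/ (FineSelmerCongruentCurves.lean and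
FineSelmerClassGroupCriterionThm34Proofs.lean respectively).
-/

open Literature.NumberTheory.EllipticCurves

/-- **S3 — stub_publishedInputs_LS18_CS05**: the two printed transfers (Lim–Sujatha 2018 Prop. 3.2 and
Coates–Sujatha 2005 Thm. 3.4) as named Literature facts, both discharged in Literature/. -/
theorem stub_publishedInputs_LS18_CS05 :
    LimSujatha2018.prop32_fineSelmerDual_moduleFinite_iff_of_torsionIso ∧
      CoatesSujatha2005.thm34_fineSelmerDual_moduleFinite_of_classicalMuVanishes_divisionField :=
  ⟨LimSujatha2018.prop32_fineSelmerDual_moduleFinite_iff_of_torsionIso_holds,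
    CoatesSujatha2005.thm34_fineSelmerDual_moduleFinite_of_classicalMuVanishes_divisionField_holds⟩
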